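import Summits.QuantumFields.YangMills.Theorems.BalabanUVNodesN07SplitClauseHeadAtMeetCube
import HarnessLib

/-!
# N07 [B11] (= [15] = [Balaban1985Variational]) Sect. F, S6 HEAD — FILE C §3 **WITH PRINT's NEAR CLASS «BOTH END BLOCKS UNDER THE NEXT CUBE» AND THE LEVEL-WEIGHTED FAR
# DATUM ROW ((152) WITH (156)–(157))**: the (159)-assembly at print's (150) family `D″ = cubeDomains ⊓ domainsOfSeq Ω` (n07-w4 g5 `…N07SplitClauseHeadAtMeetCube.localGaugeSplitOn_head159_meetCube_box`)
# re-stated with (e3) the near class `j(c) = k ∨ (B(c₋) ∈ □_{j(c)+1} ∧ B(c₊) ∈ □_{j(c)+1})` in place of `j(c) = k ∨ B(c₋) ∈ □_{j(c)+1}` — the cure of ⚑ LOCATED-DENT-BOUNDARY — and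
# (W) the far-class row `‖B c‖ ≤ β₂·(ρ + M)·L^{(K−n) − j(c)}` in place of the level-UNIFORM `‖B c‖ ≤ β₂·(ρ + M)` — the cure of ⚑ LOCATED-FAR-ROW-WEIGHT (cell bus, dag-n07-e g24 ∕ g26)

Cell `pub-ymgap`, seat `pub-ymgap-dag-n07-e` g26 (FAN-OUT §N07 row s3; LANE OWNER of the K0 road), MODULE 77a (INTENT-77, cell bus).  `--kind proof --supports stmt-QuantumFields-20541 --as helper`
(K0⁷); count-neutral; def-free; ONE theorem.  [15] = [Balaban1985Variational]; [6] = [Balaban1985RegularSpaces]; [4] = [Balaban1984PropagatorsII]; [3] = [Balaban1985Averaging].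

WHY (⚑ LOCATED-FAR-ROW-WEIGHT, lane-owner audit of the chart interface).  Print pp. 301–302: on the far cells `c ∈ Λ′_{j′}`, `j′ < k`, of the (150) family the datum is the block average of `A` — (156) `Q_{j′}(ηA) = B`, (157) `L^{j′}η·Q_{j′}A′ = B` on `Λ′_{j′}` — and
(152) `L^{j′}η|A| < 9dL²B₁Mε₀` on `Ω′_{j′}` makes print's `B` (COARSE units of `Λ′_{j′}`) uniformly `O(Mε₀)` ((155)); the PLAIN average of `A` in the top-level unit `η_k` therefore carries the
conversion factor `(L^{j′}η)⁻¹ = L^{k−j′}` — LEVEL-WEIGHTED, growing toward the fine levels; (161)∕(163)–(164) pay that weight with the kernel decay of `H` at the uniform cost `¼M_Δ·½ε₀`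
(ref-G g31 units note, cell bus).  The tree's `HB` door under
the head, n07-w4's `N07Letters10NearTopDoors.letters10On_HB_of_core_adm22_T4_nearClassW_nearTop`, takes exactly that shape (far size `C_d·M_Δ·ε(j(c))·L^{(K−n)−j(c)}·(distBI + 1)` at cost
`¼M_Δ·θ·ε(K−n)`), and so do k0-s1-w3's `K0S5FarCollarLetters` doors; FILE C §3 instantiates it with the constant family `ε := fun _ => β₂` and DISCARDS the weight `1 ≤ L^{(K−n)−j(c)}` in its far
`calc`, displaying the level-UNIFORM hypothesis `‖B c‖ ≤ β₂·(ρ + M)`.  For the chart lane that uniform row is not suppliable from the S3 door's (T1)∕(T2) (67c: `‖A b‖ < κ·ε_j·L^{j−j′}` on `□_{j′}`):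
`‖(QA)(c)‖` is as large as `κ·ε_j·L^{j−j(c)}` at the level-`j(c)` collar, a uniform `β₂` would have to carry `L^{j}`, and HBUDGET's `¼·S·θ_H·β₂ < t₂` (`θ_H ≥ 8C_HB_He^{−δ_Hρ}`, `ρ` fixed
before `K`) fails for large heights.  (e3) ⚑ LOCATED-DENT-BOUNDARY (dag-n07-e g24, `OUTWARD-MEET-EDITION-SPEC.md` §11): FILE C's near class «level `k`, or SOURCE block in the next cube» contains, at level `k − 1`, the
`D″`-cells from a dent block `y ∈ □_k ∖ Ω_k` on the outer face of `□_k` into the adjacent block `y′ ∉ □_k`; print (160) claims the centred δ-type datum only for «⟨x₁,x′₁⟩ ⊂ B(x) ∪ B(x′)» with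
BOTH `x, x′ ∈ □″_k ∪ □′_k`, and indeed no δ-type row exists for those boundary bonds (their comparison plaquettes lie in `B(y′) ⊂ Ω_k`, constrained only at ε-precision); they belong to the far
class (155), and they ARE `ρ`-far: P13's collar at the TARGET block (§1 `le_distBI_of_not_cubeDeep_tgt` — the unit step `c₊ = c₋ + e_μ` is absorbed by the `+1` slack of P13's margin, so
`R′ = ρ` and the (163)-row `8C_HB_He^{−δ_Hρ} ≤ θ` are UNCHANGED).  THIS FILE re-states FILE C §3 with (e3) print's near class `j(c) = k ∨ (B(c₋) ∈ □_{j(c)+1} ∧ B(c₊) ∈ □_{j(c)+1})` in the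
near AND far hypotheses and (W) the weight RESTORED in the far hypothesis — `¬near c → ‖B c‖ ≤ β₂·(ρ + M)·L^{(K−n) − j(c)}` — and the same proof (FILE C §1 `inOm_pred_meet_of_mem_box`, §2
`localGaugeSplitOn_of_gauge152_recordShear_dominated_meetCube_box`, the near-class door with `near :=` the (e3) class, `near_of_centred_box_anyLevel`, and §1's `hcollar_of_not_nearBoth` for
`hcollar_of_not_near` BY NAME); the thresholds `¼·M·max(4C_HB_Hβ₁, θβ₂) < t₂`, `2C_HB_Hs < t₃` and the (163)-row are UNCHANGED.  FILE C stays correct AS STATED (its hypotheses are stronger: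
more near cells, uniform far datum); the knits of record (59 ∕ 65a ∕ 67a ∕ 67c) get the twins 77b ∕ 77c.

WHAT IS PROVED (sorry-free; no definition; axioms standard).  §1 ★ `le_distBI_of_not_cubeDeep_tgt` (any family `D′` of height `k`: a cell below the top whose TARGET block is not in
`□_{j(c)+1}^{(j(c)+1)}` is `ρ`-far from every bond based in `π(□)`), ★★ `hcollar_of_not_nearBoth` (the window collar for the complement of print's near class).  §2 ★★★
`localGaugeSplitOn_head159_meetCube_box_farW (F N)` — FILE C §3 verbatim except: the near datum row is asked on print's class «level `K − n`, or BOTH end blocks in the next cube», and the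
far datum row reads `‖B c‖ ≤ β₂·(ρ + M)·L^{(K−n) − c.1.1}` on its complement.
HONEST SCOPE.  Count-neutral re-statement of a landed composition; the meet's admissibility, the collar «π(□) ⊆ Ω_{k−1}», S3's gauge, the (159) objects and identity, `A₁`'s letters, the data
sizes, the Landau copy's rows, the thresholds are HYPOTHESES — displayed, not discharged; nothing of [15]∕[6]∕[4]∕[3] ANALYSIS asserted; `DatumGaugeSplitTopStepCore(G∕R)` ∕ `HalvingStepTop(Core)` ∕
`stub_prop8StepCoPG13` NOT discharged; K0⁷ ∕ K1⁹ NOT closed; N07 NOT discharged; counts unmoved (typed 28∕28 · discharged 8∕27 per the chair); one finite 𝕋⁴ programme at fixed ε — the route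
closes the conditional finite-𝕋⁴ rung `BalabanLadder.UV` ONLY; the YM mass gap (Clay) is NOT proved by any of this; nothing continuum ∕ ℝ⁴ ∕ OS.  No `sorry` ∕ `def` ∕ `instance` ∕ `notation`.

References: [15] (144) p. 300, (147)–(152) p. 301, (155) p. 302, (157)–(159) pp. 302–303, (160)–(161) p. 303, (163)–(165) p. 304, (168) p. 304; [6] (1.131) pp. 98–99;
[4] (2.1)–(2.4) p. 224, (2.60) p. 234, Cor. 2.8 (2.150)–(2.151) p. 249; [3] (85)–(88) p. 31.
-/

set_option autoImplicit false

noncomputable section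
open scoped BigOperators Matrix.Norms.L2Operator

namespace Summit.QuantumFields.YangMills.BalabanUVNodes.N07SplitClauseHeadAtMeetCubeFarW

open Literature.MathematicalPhysics.QuantumFieldTheory.Balaban1983to89
open Literature.MathematicalPhysics.QuantumFieldTheory.Balaban1983to89.Node00
open Literature.MathematicalPhysics.QuantumFieldTheory.Balaban1983to89.B12RegularSpaces111 (gaugeU expI grad)
open B15Eq112TorusCover (cover)
open B14DomainGeom (Pt)
open B5Eq117TorusCarriers (Mk)
open B5Eq118OneStroke (iterBlockOf)
open B5Prop12FieldsLattice (distSite)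
open B8Eq131Cubes (sqLo sqHi box cube)
open B11Eq115Space (levOf)
open B6SectADomainsV1 (Domains)
open B6SectAOperatorsV1 (BondIdx)
open T4Continuum (T4Family)
open T4AxialGaugeSmallField (castSite)
open B16Sect1Backgrounds (toMS)
open GaugeField (gaugeAct)
open MatrixLog (mlog)
open Summit.QuantumFields.YangMills.Theorems.FlatCubeOpsText (Adm22 distBI)
open Summit.QuantumFields.YangMills.Theorems.K0FlatCubeOpsTextP (flatH IsLevWeight)
open Summit.QuantumFields.YangMills.Theorems.HalvingQuarterCubeSeq (distBI_nonneg)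
open Summit.QuantumFields.YangMills.Theorems.K0S5MeetFamilyJunction (meet_cube_domainsOfSeq_k)
open Summit.QuantumFields.YangMills.Theorems.K0S5CollarMeetFamily (hcollar_of_not_near le_distBI_of_not_cubeDeep)
open Summit.QuantumFields.YangMills.Theorems.K0S5CollarCubeDomains (succ_le_distSite_of_not_deep pow_le_gs)
open Summit.QuantumFields.YangMills.Theorems.FlatPortChart (mul_distSite_blockOf_le)
open Summit.QuantumFields.YangMills.Theorems.FlatPortDistance (distSite_shift_le_one)
open B5RowSumsP12Lattice (distSite_comm distSite_triangle)
open B8Eq131Cubes (gs)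
open Summit.QuantumFields.YangMills.Theorems.K0S5NearCentredAnyLevel (near_of_centred_box_anyLevel)
open Summit.QuantumFields.YangMills.BalabanUVNodes.N07CubeDomainsAdm22 (inOm_top_cubeDomains_of_mem_box)
open Summit.QuantumFields.YangMills.BalabanUVNodes.N07HalvingStepTopOfLocalLetters (Letters10On)
open Summit.QuantumFields.YangMills.BalabanUVNodes.N07LocalLettersSplitCore (LocalGaugeSplitOn)
open Summit.QuantumFields.YangMills.BalabanUVNodes.N07SplitClauseBoxesCubeDomains (levelBoxes_of_Om_subset_cubeDomains)
open Summit.QuantumFields.YangMills.BalabanUVNodes.N07SplitClauseRecordShearAtCubeDomains (width_mul_le_of_closedForm)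
open Summit.QuantumFields.YangMills.BalabanUVNodes.N07SplitClauseRecordShearNearTop (localGaugeSplitOn_of_gauge152_recordShear_dominated_adm22_T4_nearTop)
open Summit.QuantumFields.YangMills.BalabanUVNodes.N07Letters10NearTopDoors (letters10On_HB_of_core_adm22_T4_nearClassW_nearTop)
open Summit.QuantumFields.YangMills.BalabanUVNodes.N07SplitClauseHeadAtMeetCube (inOm_pred_meet_of_mem_box localGaugeSplitOn_of_gauge152_recordShear_dominated_meetCube_box)

/-! ## §1  The collar for print's NEAR class «both end blocks under the next cube» ((e3) of ⚑ LOCATED-DENT-BOUNDARY) -/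

/-- ★ **THE CORE COLLAR FROM THE TARGET BLOCK**: for `b₋ = π x`, `x ∈ □ = box L a M k`, and every index bond `c` of a family `D′` of height `k` at a level `j(c) < k` whose TARGET block does
NOT lie in `□_{j(c)+1}^{(j(c)+1)}` of the cube tower: `ρ ≤ distBI D′ b c` — k0-s1-w3's `le_distBI_of_not_cubeDeep` read at `c₊` (P13 `succ_le_distSite_of_not_deep` at the target block,
one level down by `mul_distSite_blockOf_le`, and the unit step `c₊ = c₋ + e_μ` costs `1 ≤` the slack `+1` of P13's margin). [cite: Balaban1985Variational, (144) p.300, (147)–(150) p.301, (161) p.303; Balaban1985RegularSpaces, (1.131) p.99; Balaban1984PropagatorsII, (2.3) p.224] -/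
theorem le_distBI_of_not_cubeDeep_tgt {P : Params} {a : Pt P.d} {M ρ k : ℕ} {hk : k ≤ P.m + P.K} {D' : Domains P} (hD'k : D'.k = k)
    {x : Pt P.d} (hx : x ∈ box P.L a M k) {b : PBond P 0} (hb : b.src = cover P x)
    (c : BondIdx D') (hc : (c.1.1 : ℕ) < k) (hnd : blockOf c.1.2.tgt ∉ (cubeDomains P a M ρ k hk).Om ((c.1.1 : ℕ) + 1)) :
    (ρ : ℝ) ≤ distBI D' b c := by
  set j : ℕ := (c.1.1 : ℕ) with hj
  obtain ⟨i, hi⟩ : ∃ i : ℕ, k = j + 1 + i := ⟨k - j - 1, by omega⟩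
  have hjk : j + 1 ≤ k := by omega
  have hj1 : j + 1 ≤ P.m + P.K := hjk.trans hk
  have hL1 : (1 : ℝ) ≤ P.L := by exact_mod_cast P.L_pos
  have hL0 : (0 : ℝ) ≤ P.L := by linarith
  -- (1) the target block is not in the next cube; P13 §2 at level `j + 1`
  have h2 := succ_le_distSite_of_not_deep (hk := hk) hjk hnd hx
  rw [← hb] at h2
  -- (2) one level down, at the target
  have hdown := mul_distSite_blockOf_le hj1 (iterBlockOf j b.src) c.1.2.tgt
  have hsucc : blockOf (iterBlockOf j b.src) = iterBlockOf (j + 1) b.src := rfl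
  rw [hsucc] at hdown
  have hki : k - (j + 1) = i := by omega
  rw [hki] at h2
  -- (3) the unit step from `c₊` back to `c₋`
  have hstep : distSite (Mk P j) (iterBlockOf j b.src) c.1.2.tgt ≤ distSite (Mk P j) (iterBlockOf j b.src) c.1.2.src + 1 := by
    have htri := distSite_triangle (Mk P j) (iterBlockOf j b.src) c.1.2.src c.1.2.tgt
    have h1 : distSite (Mk P j) c.1.2.src c.1.2.tgt ≤ 1 := by
      rw [distSite_comm]
      exact distSite_shift_le_one c.1.2.src c.1.2.dir
    linarith
  -- `dist_j(c₋) ≥ L·(ρ·gs i + 1) − (L − 1) − 1 = L·ρ·gs i ≥ ρ·L^{i+1}`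
  have hlevj : (P.L : ℝ) * ((ρ : ℝ) * gs P.L i) ≤ distSite (Mk P j) (iterBlockOf j b.src) c.1.2.src := by
    have := mul_le_mul_of_nonneg_left h2 hL0
    linarith
  have hgs : (P.L : ℝ) ^ i ≤ (gs P.L i : ℝ) := by exact_mod_cast pow_le_gs P.L i
  have hρ0 : (0 : ℝ) ≤ ρ := Nat.cast_nonneg _
  have hmain : (ρ : ℝ) * (P.L : ℝ) ^ (i + 1) ≤ distSite (Mk P j) (iterBlockOf j b.src) c.1.2.src := by
    have h1 : (ρ : ℝ) * (P.L : ℝ) ^ (i + 1) ≤ (P.L : ℝ) * ((ρ : ℝ) * gs P.L i) := by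
      rw [pow_succ]
      have := mul_le_mul_of_nonneg_left hgs hρ0
      nlinarith
    linarith
  -- (4) the scaling of `distBI` (`D′.k = k`)
  have hkj : D'.k - (c.1.1 : ℕ) = i + 1 := by omega
  unfold distBI
  rw [hkj, inv_pow, le_inv_mul_iff₀ (by positivity : (0 : ℝ) < (P.L : ℝ) ^ (i + 1))]
  linarith

/-- ★★ **THE WINDOW COLLAR FOR PRINT's NEAR CLASS** «the cell is at the top, or BOTH its end blocks lie in the next cube of the tower» ([15] p. 303 (160) «⟨x₁,x′₁⟩ ⊂ B(x) ∪ B(x′)»,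
`x, x′ ∈ □″_k ∪ □′_k`; cure (e3) of dag-n07-e's ⚑ LOCATED-DENT-BOUNDARY): for ANY family `D′` of height `k`, every cell OUTSIDE that class is `ρ`-far from every bond based in `π(□)` —
k0-s1-w3's `hcollar_of_not_near` (source block outside) and §1's target twin (target block outside). [cite: Balaban1985Variational, (144) p.300, (147)–(150) p.301, (160)–(161) p.303] -/
theorem hcollar_of_not_nearBoth {P : Params} {a : Pt P.d} {M ρ k : ℕ} {hk : k ≤ P.m + P.K} {D' : Domains P} (hD'k : D'.k = k) :
    ∀ b : PBond P 0, b.src ∈ cover P '' box P.L a M k →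
      ∀ c : BondIdx D', ¬ ((c.1.1 : ℕ) = k ∨ (blockOf c.1.2.src ∈ (cubeDomains P a M ρ k hk).Om ((c.1.1 : ℕ) + 1) ∧
          blockOf c.1.2.tgt ∈ (cubeDomains P a M ρ k hk).Om ((c.1.1 : ℕ) + 1))) →
        (ρ : ℝ) ≤ distBI D' b c := by
  intro b hb c hc
  obtain ⟨x, hx, hbx⟩ := hb
  obtain ⟨hne, hnd⟩ := not_or.mp hc
  have hle : (c.1.1 : ℕ) ≤ k := by have := c.1.1.isLt; omega
  have hlt : (c.1.1 : ℕ) < k := lt_of_le_of_ne hle hne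
  rcases not_and_or.mp hnd with hs | ht
  · exact le_distBI_of_not_cubeDeep hD'k hx hbx.symm c hlt hs
  · exact le_distBI_of_not_cubeDeep_tgt hD'k hx hbx.symm c hlt ht

/-! ## §2  FILE C §3 at the meet with print's NEAR class and the LEVEL-WEIGHTED far datum row ((152) with (156)–(157)) -/

open scoped Classical in
/-- ★★★ **THE (159)-ASSEMBLY AT PRINT's (150) FAMILY AND THE HEAD's WINDOW, PRINT's NEAR CLASS, FAR DATUM LEVEL-WEIGHTED** — n07-w4 g5's FILE C §3 `localGaugeSplitOn_head159_meetCube_box`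
with (e3) the near class «level `k`, or BOTH end blocks in the next cube» (print (160) «⟨x₁,x′₁⟩ ⊂ B(x) ∪ B(x′), x, x′ ∈ □″_k ∪ □′_k») and (W) the far-class row `‖B c‖ ≤ β₂·(ρ + M)·L^{(K−n) − j(c)}`
(print (152) read through (156)–(157): the plain block average of `A` on `Λ′_j`, `j < k`, in the unit `η_{K−n}` carries `(L^{j}η)⁻¹`) instead of the uniform
`β₂·(ρ + M)`; otherwise verbatim: §2's record door with
`A₂ := H_V B` (data in print's shapes: (160) CENTRED at a window point `x_c ∈ □` on the near class «top level, or both end blocks in the next cube» — print's `□″_k^{(k)} ∪ □′_k^{(k−1)}` pairs plus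
the top cells —, (152)∕(156)–(157) WEIGHTED `β₂·(ρ + M)·L^{(K−n)−j(c)}` on its complement, which is `ρ`-far: §1 `hcollar_of_not_nearBoth`) and `A₃ := H_V B′` (`‖B′ c‖ ≤ s`) supplied by FILE A's near-top
`HB` door at the same family ∕ window, `H`-constants shared; displayed: the meet's admissibility, the collar «π(□) ⊆ Ω_{K−n−1}», `H_V`'s kernel formula, the data sizes, `s`, `A₁`'s
letters, S3's gauge and (152) letters, the identity `A − H_V X = A₁ + H_V B − H_V B′`, the Landau copy's rows, the thresholds.
[cite: Balaban1985Variational, (144) p.300, (147)–(152) p.301, (155) p.302, (157)–(159) pp.302–303, (160)–(161) p.303, (163)–(165) p.304, (168) p.304; Balaban1985RegularSpaces, (1.131) pp.98–99; Balaban1984PropagatorsII, (2.1)–(2.4) p.224, (2.60) p.234, Cor. 2.8 (2.150)–(2.151) p.249; Balaban1985Averaging, (85)–(88) p.31] -/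
theorem localGaugeSplitOn_head159_meetCube_box_farW (F : T4Family) (N : ℕ) [NeZero N] :
    ∃ (Mh₀ R₀ : ℕ) (CS BS CH δH BH : ℝ), 0 ≤ CS ∧ 0 < BS ∧ 0 ≤ CH ∧ 0 < δH ∧ 0 < BH ∧
    ∀ (n K : ℕ) (_ : 1 ≤ K - n) (_ : K - n + 1 ≤ F.m + K) (hk : K - n ≤ (F.P K).m + (F.P K).K)
      {Mh R a' : ℕ} (_ : Mh = F.L ^ a') (_ : Mh₀ ≤ Mh) (_ : R₀ ≤ R) (_ : a' + 3 ≤ F.m + n)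
      {a : Pt (F.P K).d} {M ρ : ℕ} (_ : 1 ≤ M) (_ : F.L ≤ ρ) (_ : Set.InjOn (cover (F.P K)) (cube (F.P K).L a M ρ (K - n) 0))
      -- the record side of the meet: a decreasing, saturated sequence with the window inside `Ω_{K−n−1}` (when `K − n ≥ 2`), and the meet's admissibility
      (Ω : ℕ → Set (Site (F.P K) 0)) (_ : ∀ i : ℕ, 1 ≤ i → i < K - n → Ω (i + 1) ⊆ Ω i)
      (_ : ∀ (j : ℕ) (x x' : Site (F.P K) 0), 1 ≤ j → j ≤ K - n → iterBlockOf j x = iterBlockOf j x' → x ∈ Ω j → x' ∈ Ω j)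
      (_ : 2 ≤ K - n → ∀ x ∈ box (F.P K).L a M (K - n), cover (F.P K) x ∈ Ω (K - n - 1))
      (_ : Adm22 (domainsMeet (cubeDomains (F.P K) a M ρ (K - n) hk) (domainsOfSeq Ω (K - n) hk)) R (F.L * Mh))
      {HV : (BondIdx (domainsMeet (cubeDomains (F.P K) a M ρ (K - n) hk) (domainsOfSeq Ω (K - n) hk)) → MatA N) →ₗ[ℂ] (PBond (F.P K) 0 → MatA N)}
      (_ : ∀ (B : BondIdx (domainsMeet (cubeDomains (F.P K) a M ρ (K - n) hk) (domainsOfSeq Ω (K - n) hk)) → MatA N) (b : PBond (F.P K) 0),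
        HV B b = ∑ c, ((flatH (F.P K) (K - n) (domainsMeet (cubeDomains (F.P K) a M ρ (K - n) hk) (domainsOfSeq Ω (K - n) hk)) (Pi.single c 1) b : ℝ) : ℂ) • B c)
      -- the `HB` summand's datum in print's shapes: (160) centred at a window point on print's near class «top, or BOTH end blocks in the next cube», (152)∕(156)–(157) LEVEL-WEIGHTED
      -- `β₂(ρ + M)·L^{(K−n)−j(c)}` on its complement; the (163)-type smallness of `θ`
      {xc : Pt (F.P K).d} (_ : xc ∈ box (F.P K).L a M (K - n))
      {β₁ β₂ θ : ℝ} (_ : 0 ≤ β₁) (_ : 0 ≤ β₂) (_ : 8 * CH * BH * Real.exp (-(δH * (ρ : ℝ))) ≤ θ)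
      {B : BondIdx (domainsMeet (cubeDomains (F.P K) a M ρ (K - n) hk) (domainsOfSeq Ω (K - n) hk)) → MatA N}
      (_ : ∀ c : BondIdx (domainsMeet (cubeDomains (F.P K) a M ρ (K - n) hk) (domainsOfSeq Ω (K - n) hk)),
        ((c.1.1 : ℕ) = K - n ∨ (blockOf c.1.2.src ∈ (cubeDomains (F.P K) a M ρ (K - n) hk).Om ((c.1.1 : ℕ) + 1) ∧
          blockOf c.1.2.tgt ∈ (cubeDomains (F.P K) a M ρ (K - n) hk).Om ((c.1.1 : ℕ) + 1))) →
          ‖B c‖ ≤ β₁ * (distSite (Mk (F.P K) (c.1.1 : ℕ)) c.1.2.src (iterBlockOf (c.1.1 : ℕ) (cover (F.P K) xc)) + 1))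
      (_ : ∀ c : BondIdx (domainsMeet (cubeDomains (F.P K) a M ρ (K - n) hk) (domainsOfSeq Ω (K - n) hk)),
        ¬ ((c.1.1 : ℕ) = K - n ∨ (blockOf c.1.2.src ∈ (cubeDomains (F.P K) a M ρ (K - n) hk).Om ((c.1.1 : ℕ) + 1) ∧
          blockOf c.1.2.tgt ∈ (cubeDomains (F.P K) a M ρ (K - n) hk).Om ((c.1.1 : ℕ) + 1))) →
          ‖B c‖ ≤ β₂ * ((ρ : ℝ) + M) * ((F.P K).L : ℝ) ^ ((K - n) - (c.1.1 : ℕ)))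
      -- the third summand's datum, uniformly small
      {B' : BondIdx (domainsMeet (cubeDomains (F.P K) a M ρ (K - n) hk) (domainsOfSeq Ω (K - n) hk)) → MatA N} {s : ℝ} (_ : 0 ≤ s) (_ : ∀ c, ‖B' c‖ ≤ s)
      -- the CANONICAL level boxes of the cube tower (four equation binders)
      {lo hi : ℕ → Pt (F.P K).d}
      (_ : lo 0 = fun i => ((F.P K).L : ℤ) * (sqLo (F.P K).L a ρ (K - n) 1 i - 1))
      (_ : hi 0 = fun i => ((F.P K).L : ℤ) * (sqHi (F.P K).L a M ρ (K - n) 1 i + 1) + (((F.P K).L : ℤ) - 1))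
      (_ : ∀ j, 1 ≤ j → lo j = sqLo (F.P K).L a ρ (K - n) j - 1) (_ : ∀ j, 1 ≤ j → hi j = sqHi (F.P K).L a M ρ (K - n) j + 1)
      -- the (r1)+(r4) row's Landau copy, its gauge, the per-level bond letters on the canonical boxes, the uniform `σ` against the closed-form widths
      (uL : GaugeTransf (F.P K) 0 (SU N)) (U₁ : GaugeField (F.P K) 0 (SU N)) (v av : ℕ → ℝ) {σ : ℝ}
      (_ : ∀ j, 0 ≤ v j) (_ : ∀ j, 0 ≤ av j) (_ : σ ≤ 1 / 2)
      (_ : ∀ j ≤ K - n, (((F.P K).d * ((M + 4 * ρ + 3) * (F.P K).L ^ ((K - n) - j)) : ℕ) : ℝ) * (v j + av j) ≤ σ)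
      (_ : ∀ j ≤ K - n, ∀ c : PBond (F.P K) j, c.src ∈ (castSite '' Set.Icc (lo j) (hi j) : Set (Site (F.P K) j)) →
        c.tgt ∈ (castSite '' Set.Icc (lo j) (hi j) : Set (Site (F.P K) j)) → dist1 (Averaging.iter (avOfRecord F N K) j (gaugeAct uL U₁) c) ≤ v j)
      (_ : ∀ j ≤ K - n, ∀ c : PBond (F.P K) j, c.src ∈ (castSite '' Set.Icc (lo j) (hi j) : Set (Site (F.P K) j)) →
        c.tgt ∈ (castSite '' Set.Icc (lo j) (hi j) : Set (Site (F.P K) j)) → dist1 (Averaging.iter (avOfRecord F N K) j U₁ c) ≤ av j)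
      -- the shift family, dominated by the (r1) letter family, and its datum
      (lam : (j : ℕ) → Site (F.P K) j → MatA N)
      (_ : ∀ (j : ℕ) (y : Site (F.P K) j), ‖lam j y‖ ≤ ‖mlog (((((toMS uL j (castSite (lo j)))⁻¹ * toMS uL j y)⁻¹ : SU N)) : MatA N)‖)
      {X : BondIdx (domainsMeet (cubeDomains (F.P K) a M ρ (K - n) hk) (domainsOfSeq Ω (K - n) hk)) → MatA N}
      (_ : ∀ c : BondIdx (domainsMeet (cubeDomains (F.P K) a M ρ (K - n) hk) (domainsOfSeq Ω (K - n) hk)),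
        X c = LatticeFieldCalculus.grad (((F.P K).L : ℝ) ^ (K - n) / ((F.P K).L : ℝ) ^ (c.1.1 : ℕ)) (lam c.1.1) c.1.2)
      -- S3's gauge of `U` on the window, the first summand with its letters, and the (159) identity
      {U : GaugeField (F.P K) 0 (SU N)} (u : GaugeTransf (F.P K) 0 (SU N)) {A A₁ : PBond (F.P K) 0 → MatA N} {t t₁ : ℝ}
      (_ : ∀ b ∈ (Sect2.regionOfSet (F.P K) (cover (F.P K) '' box (F.P K).L a M (K - n))).bonds,
        gaugeU (fun x => ιSU N (u x)) (fun b' => ιSU N (U b')) b = expI ((F.P K).eta (K - n)) (A b))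
      (_ : ∀ b ∈ (Sect2.regionOfSet (F.P K) (cover (F.P K) '' box (F.P K).L a M (K - n))).bonds, ‖A b‖ < t)
      (_ : ∀ q ∈ (Sect2.regionOfSet (F.P K) (cover (F.P K) '' box (F.P K).L a M (K - n))).dpairs,
        ‖grad ((F.P K).eta (K - n)) q.2.1 (fun y => A ⟨y, q.2.2⟩) q.1‖ < t)
      (_ : Letters10On (cover (F.P K) '' box (F.P K).L a M (K - n)) ((F.P K).eta (K - n)) t₁ A₁)
      (_ : ∀ b, A b - HV X b = A₁ b + HV B b - HV B' b)
      -- thresholds in the doors' currencies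
      {t₂ t₃ tD : ℝ} (_ : 1 / 4 * (M : ℝ) * max (4 * CH * BH * β₁) (θ * β₂) < t₂) (_ : 2 * CH * BH * s < t₃) (_ : 2 * CS * BS * (4 * σ) < tD),
      LocalGaugeSplitOn (cover (F.P K) '' box (F.P K).L a M (K - n)) ((F.P K).eta (K - n)) t (t₁ + (t₂ + tD) + t₃) U := by
  obtain ⟨MhS, RS, CS, δS₀, δS, BS, hCS, _, _, hBS, hshear⟩ := localGaugeSplitOn_of_gauge152_recordShear_dominated_meetCube_box F N
  obtain ⟨MhH, RH, CH, δH₀, δH, BH, hCH, _, hδH, hBH, hH⟩ := letters10On_HB_of_core_adm22_T4_nearClassW_nearTop F N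
  refine ⟨max MhS MhH, max RS RH, CS, BS, CH, δH, BH, hCS, hBS, hCH, hδH, hBH, ?_⟩
  intro n K hk1 hk' hk Mh R a' hMha hMh hR hsize a M ρ hM1 hLρ hinj Ω hnest hsat hbox' hAdm HV hHV xc hxc β₁ β₂ θ hβ₁ hβ₂ h163 B hX₁ hX₂ B' s hs hB'
    lo hi hlo0 hhi0 hloj hhij uL U₁ v av σ hv0 ha0 hσ hDσ hv hav lam hlam X hX U u A A₁ t t₁ he hA hdA h₁ h159 t₂ t₃ tD ht₂ ht₃ htD
  have hMhS : MhS ≤ Mh := (le_max_left _ _).trans hMh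
  have hMhH : MhH ≤ Mh := (le_max_right _ _).trans hMh
  have hRS : RS ≤ R := (le_max_left _ _).trans hR
  have hRH : RH ≤ R := (le_max_right _ _).trans hR
  have hMr : (1 : ℝ) ≤ M := by exact_mod_cast hM1
  have hM0 : (0 : ℝ) ≤ M := by linarith
  have hL1 : (1 : ℝ) ≤ ((F.P K).L : ℝ) := by exact_mod_cast (F.P K).L_pos
  -- the meet's height, the near-top window (§1), the far class's collar (k0-s1-w3)
  have hDk : (domainsMeet (cubeDomains (F.P K) a M ρ (K - n) hk) (domainsOfSeq Ω (K - n) hk)).k = K - n := meet_cube_domainsOfSeq_k Ω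
  have hY := inOm_pred_meet_of_mem_box (ρ := ρ) (hk := hk) Ω hinj hk1 hnest hsat hbox'
  have hcollar := hcollar_of_not_nearBoth (P := F.P K) (a := a) (M := M) (ρ := ρ) (hk := hk) hDk
  have hkK : (domainsMeet (cubeDomains (F.P K) a M ρ (K - n) hk) (domainsOfSeq Ω (K - n) hk)).k ≤ (F.P K).m + (F.P K).K := by rw [hDk]; exact hk
  have hw : IsLevWeight (F.P K) (K - n) (domainsMeet (cubeDomains (F.P K) a M ρ (K - n) hk) (domainsOfSeq Ω (K - n) hk))
      (fun m b => (((F.P K).L : ℝ) ^ levOf (fun j => {x : Site (F.P K) 0 | (domainsMeet (cubeDomains (F.P K) a M ρ (K - n) hk) (domainsOfSeq Ω (K - n) hk)).InOm j x})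
        (K - n) b.src * (((F.P K).L : ℝ)⁻¹) ^ (K - n)) ^ m) := fun _ _ => rfl
  -- the `HB` letter (A₂ := H_V B): (160) centred ⇒ the near-class hypothesis at every level (`C_d·M_Δ·ε₁ := β₁·M`), (152)∕(157) level-weighted ⇒ the far one via the collar (weight kept)
  have hxc' : xc ∈ box (F.P K).L a M (domainsMeet (cubeDomains (F.P K) a M ρ (K - n) hk) (domainsOfSeq Ω (K - n) hk)).k := by rw [hDk]; exact hxc
  have hnear := near_of_centred_box_anyLevel (domainsMeet (cubeDomains (F.P K) a M ρ (K - n) hk) (domainsOfSeq Ω (K - n) hk)) (a := a) (M := M) hkK hM1 hxc' _ hβ₁ hX₁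
  have h₂ : Letters10On (cover (F.P K) '' box (F.P K).L a M (K - n)) ((F.P K).eta (K - n)) t₂ (HV B) := by
    refine hH n K hk1 hk' hMha hMhH hRH hsize _ hDk hAdm _ hw (Cd := 1) (MΔ := (M : ℝ)) (ε₁ := β₁) (θ := θ) (R' := (ρ : ℝ))
      (ε := fun _ => β₂) zero_le_one hM0 hβ₁ hβ₂ (fun _ _ => by linarith) (by simpa using h163) _ hY hcollar hHV
      (fun b hb c hc => ?_) (fun b hb c hc => ?_) (by simpa using ht₂)
    · have hb' : b.src ∈ cover (F.P K) '' box (F.P K).L a M (domainsMeet (cubeDomains (F.P K) a M ρ (K - n) hk) (domainsOfSeq Ω (K - n) hk)).k := by rw [hDk]; exact hb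
      have h := hnear b hb' c hc
      have hKk : (domainsMeet (cubeDomains (F.P K) a M ρ (K - n) hk) (domainsOfSeq Ω (K - n) hk)).k - (c.1.1 : ℕ) = (K - n) - (c.1.1 : ℕ) := by omega
      rw [hKk] at h
      calc ‖B c‖ ≤ β₁ * M * ((F.P K).L : ℝ) ^ ((K - n) - (c.1.1 : ℕ)) * (distBI _ b c + 1) := h
        _ = 1 * (M : ℝ) * β₁ * ((F.P K).L : ℝ) ^ ((K - n) - (c.1.1 : ℕ)) * (distBI _ b c + 1) := by ring
    · -- the far class is `ρ`-far (k0-s1-w3's collar) and the door's far size CARRIES the level weight `L^{(K−n)−j(c)}`: nothing is discarded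
      have hpow : (0 : ℝ) ≤ ((F.P K).L : ℝ) ^ ((K - n) - (c.1.1 : ℕ)) := by positivity
      have hρd : (ρ : ℝ) ≤ distBI _ b c := hcollar b hb c hc
      have hd0 : (0 : ℝ) ≤ distBI (domainsMeet (cubeDomains (F.P K) a M ρ (K - n) hk) (domainsOfSeq Ω (K - n) hk)) b c := (Nat.cast_nonneg ρ).trans hρd
      calc ‖B c‖ ≤ β₂ * ((ρ : ℝ) + M) * ((F.P K).L : ℝ) ^ ((K - n) - (c.1.1 : ℕ)) := hX₂ c hc
        _ ≤ β₂ * (M * (distBI _ b c + 1)) * ((F.P K).L : ℝ) ^ ((K - n) - (c.1.1 : ℕ)) :=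
            mul_le_mul_of_nonneg_right (mul_le_mul_of_nonneg_left (by nlinarith) hβ₂) hpow
        _ = 1 * (M : ℝ) * β₂ * ((F.P K).L : ℝ) ^ ((K - n) - (c.1.1 : ℕ)) * (distBI _ b c + 1) := by ring
  -- the uniform letter (A₃ := H_V B′), same `H`-constants: near class everything, `R′ = 0`, `θ := 8CB₃`, `C_d = M_Δ = 1`
  have h₃ : Letters10On (cover (F.P K) '' box (F.P K).L a M (K - n)) ((F.P K).eta (K - n)) t₃ (HV B') := by
    have h163' : 8 * (1 : ℝ) * CH * BH * Real.exp (-(δH * 0)) ≤ 8 * CH * BH := by simp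
    have hmax : 1 / 4 * (1 : ℝ) * max (4 * 1 * CH * BH * s) (8 * CH * BH * s) < t₃ := by
      have hCB : 0 ≤ CH * BH * s := by positivity
      rw [max_eq_right (by nlinarith)]
      linarith
    refine hH n K hk1 hk' hMha hMhH hRH hsize _ hDk hAdm _ hw (Cd := 1) (MΔ := 1) (ε₁ := s) (θ := 8 * CH * BH) (R' := 0) (ε := fun _ => s)
      zero_le_one zero_le_one hs hs (fun _ _ => by linarith) h163' (fun _ => True) hY (fun b _ c hc => absurd trivial hc) hHV
      (fun b _ c _ => ?_) (fun b _ c hc => absurd trivial hc) hmax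
    have hd := distBI_nonneg (domainsMeet (cubeDomains (F.P K) a M ρ (K - n) hk) (domainsOfSeq Ω (K - n) hk)) b c
    have hpow : (1 : ℝ) ≤ ((F.P K).L : ℝ) ^ ((K - n) - (c.1.1 : ℕ)) := one_le_pow₀ hL1
    calc ‖B' c‖ ≤ s := hB' c
      _ = s * 1 * 1 := by ring
      _ ≤ s * ((F.P K).L : ℝ) ^ ((K - n) - (c.1.1 : ℕ)) * (distBI _ b c + 1) :=
          mul_le_mul (mul_le_mul_of_nonneg_left hpow hs) (by linarith) zero_le_one (by positivity)
      _ = 1 * 1 * s * ((F.P K).L : ℝ) ^ ((K - n) - (c.1.1 : ℕ)) * (distBI _ b c + 1) := by ring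
  -- the shift side: §2 with `A₂ := H_V B`, `A₃ := H_V B′`
  exact hshear n K hk1 hk' hk hMha hMhS hRS hsize hLρ hinj Ω hnest hsat hbox' hAdm hHV hlo0 hhi0 hloj hhij uL U₁ v av hv0 ha0 hσ hDσ hv hav lam hlam hX u
    he hA hdA h159 h₁ h₂ h₃ htD

end Summit.QuantumFields.YangMills.BalabanUVNodes.N07SplitClauseHeadAtMeetCubeFarW

end
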